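import Mathlib
import HarnessLib
import Literature.MathematicalPhysics.StatisticalMechanics.ReblockingCounting
import Literature.MathematicalPhysics.StatisticalMechanics.WeightedNormBounds
import Literature.MathematicalPhysics.StatisticalMechanics.RelevantHamiltonianNorm

/-!
# The large-polymer part `F` of the linearised renormalisation map `C^{(q)}` and its bound
# ([ABKM19] (6.58), (10.2), Lemma 10.2 — combinatorial form)

`(C^{(q)} K)(U) = F(U) + G(U)` ([ABKM19] (10.1)) with the LARGE-POLYMER PART
`F(U, φ) = Σ_{X ∈ 𝒫_k^c ∖ ℬ_k, π(X) = U} (R_{k+1} K(X))(φ)` ((10.2)), `R_{k+1} K(X)(φ) = ∫ K(X, φ + ξ) μ_{k+1}(dξ)`.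
Lemma 10.2 bounds `‖F‖_{k+1}^{(A)} ≤ ¼θ ‖K‖_k^{(A)}` for `A ≥ A_0(L)` by two mechanisms: the gain
`A^{|π(X)|_{k+1} − |X|_k}` for large `X` (App. A, [Bry09] Lemmas 6.15/6.16) and the count of small
polymers meeting a block.  This file isolates exactly that step:

* `largePartIndex s L U` — the index set `{X ∈ 𝒫_k^c ∖ ℬ_k : π(X) = U}` (connected `k`-polymers
  with at least two blocks and `reblock X = U`), `largePart s L R K U φ = Σ_X R (K X) φ`;
* `TayNormLE.sum` — subadditivity of the weak-norm bound over finite sums;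
* **`sum_largePartIndex_le`** — the counting inequality
  `Σ_{X} κ^{|X|_k} A^{−|X|_k} ≤ ε(A) · A^{−|U|_{k+1}}`,
  `ε(A) = 2^{L^d} κ A^{−(1−1/η)} + L^d c(d) κ² A^{−1}`, given the closure gain `η|X̄|_{k+1} ≤ |X|_k`
  for large connected `X` (hypothesis; [Bry09] Lemma 6.15 = `TorusPolymer.BrydgesClosureGain`);
* **`tayNormLE_largePart`** — Lemma 10.2 in predicate form: per-polymer bounds
  `|R K(X)|_{T_φ} ≤ C κ^{|X|_k} A^{−|X|_k} w(φ)` at the target gauge/weight of `U` (these are what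
  Lemma 8.4 + Lemma 8.1 + (w6) provide, with `κ = A_𝒫`) give
  `|F(U)|_{T_φ} ≤ C ε(A) A^{−|U|_{k+1}} w(φ)`; `ε(A) → 0` as `A → ∞`, which is the contraction.

Everything here is proved (the gain enters as a hypothesis).

## References
* S. Adams, S. Buchholz, R. Kotecký, S. Müller, arXiv:1910.13564, (6.58), (10.1)–(10.2), Lemma 10.2,
  App. A [AdamsBuchholzKoteckyMuller2019].
-/

noncomputable section

namespace Literature.MathematicalPhysics.StatisticalMechanics.GradientRG

open scoped BigOperators Classical
open Finset
open Literature.MathematicalPhysics.StatisticalMechanics.TorusPolymer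
  (IsPolymer blocks polys closure reblock blockOf mem_polys mem_blocks)
open Literature.Barriers.CriticalPhenomena.LongRangePhi4.Polymer (IsConn)
open Literature.MathematicalPhysics.QuantumFieldTheory

/-! ## Subadditivity of the weak-norm bound over finite sums -/

section Generic

variable {E V : Type*} [NormedAddCommGroup E] [NormedSpace ℝ E] [FiniteDimensional ℝ E]
  [NormedAddCommGroup V] [NormedSpace ℝ V]
  {𝔸 : Type*} [NormedRing 𝔸] [NormedAlgebra ℝ 𝔸]

/-- **`‖Σ_i F_i‖_{T,w} ≤ Σ_i C_i`** for `C^{r₀}` functionals. [cite: AdamsBuchholzKoteckyMuller2019, Ch. 6.4 (6.48)] -/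
theorem TayNormLE.sum {T : E →ₗ[ℝ] V} {r₀ : ℕ} {w : E → ℝ} {ι : Type*} (S : Finset ι)
    {F : ι → E → 𝔸} {c : ι → ℝ} (h : ∀ i ∈ S, TayNormLE T r₀ w (F i) (c i))
    (hF : ∀ i ∈ S, ContDiff ℝ r₀ (F i)) :
    TayNormLE T r₀ w (fun ψ => ∑ i ∈ S, F i ψ) (∑ i ∈ S, c i) := by
  intro φ
  refine (tayNorm_sum_le T S hF φ).trans ?_
  rw [sum_mul]
  exact sum_le_sum fun i hi => h i hi φ

end Generic

variable {d M : ℕ} [NeZero M]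

/-! ## The large-polymer part `F` ((10.2)) -/

/-- The index set of `F(U)`: connected `k`-polymers with at least two blocks (`𝒫_k^c ∖ ℬ_k`) and
`π(X) = U` (`π = reblock s (L s)`). [cite: AdamsBuchholzKoteckyMuller2019, Ch. 10.1 (10.2)] -/
def largePartIndex (s L : ℕ) (U : Finset (Fin d → ZMod M)) : Finset (Finset (Fin d → ZMod M)) :=
  (polys s univ).filter fun X => IsConn X ∧ 2 ≤ (blocks s X).card ∧ reblock s (L * s) X = U

/-- Membership in the index set of `F(U)`. [cite: AdamsBuchholzKoteckyMuller2019, Ch. 10.1 (10.2)] -/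
theorem mem_largePartIndex {s L : ℕ} {U X : Finset (Fin d → ZMod M)} :
    X ∈ largePartIndex s L U ↔ IsPolymer s X ∧ IsConn X ∧ 2 ≤ (blocks s X).card ∧
      reblock s (L * s) X = U := by
  rw [largePartIndex, mem_filter, mem_polys]
  constructor
  · rintro ⟨⟨-, hP⟩, hc, h2, hr⟩; exact ⟨hP, hc, h2, hr⟩
  · rintro ⟨hP, hc, h2, hr⟩; exact ⟨⟨subset_univ _, hP⟩, hc, h2, hr⟩

/-- **`F(U, φ) = Σ_{X ∈ 𝒫_k^c ∖ ℬ_k, π(X)=U} (R K(X))(φ)`** ((10.2)); `R` is the integration map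
`R_{k+1}` (`fluct 𝒞`), kept abstract here. [cite: AdamsBuchholzKoteckyMuller2019, Ch. 10.1 (10.2)] -/
def largePart (s L : ℕ) {E' : Type*} (R : (((Fin d → ZMod M) → ℝ) → ℂ) → E' → ℂ)
    (K : Finset (Fin d → ZMod M) → ((Fin d → ZMod M) → ℝ) → ℂ) (U : Finset (Fin d → ZMod M))
    (φ : E') : ℂ :=
  ∑ X ∈ largePartIndex s L U, R (K X) φ

/-! ## The counting inequality behind Lemma 10.2 -/

/-- The small-polymer constant `c(d) = 2^{(2^{d+1}+2)^d}` of `card_small_meeting_block_le`.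
[cite: AdamsBuchholzKoteckyMuller2019, proof of Lemma 10.2] -/
def smallPolymerConst (d : ℕ) : ℕ := 2 ^ ((2 ^ (d + 1) + 2) ^ d)

/-- The contraction factor of Lemma 10.2: `ε(A) = 2^{L^d} κ A^{−(1−1/η)} + L^d c(d) κ² A^{−1}`.
[cite: AdamsBuchholzKoteckyMuller2019, Lemma 10.2] -/
def largePartEps (d L : ℕ) (A κ η : ℝ) : ℝ :=
  (2 : ℝ) ^ (L ^ d) * (κ * A ^ (-(1 - η⁻¹) : ℝ)) + L ^ d * smallPolymerConst d * κ ^ 2 * A⁻¹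

/-- `ε(A) ≥ 0`. [cite: AdamsBuchholzKoteckyMuller2019, Lemma 10.2] -/
theorem largePartEps_nonneg (d L : ℕ) {A κ η : ℝ} (hA : 0 ≤ A) (hκ : 0 ≤ κ) :
    0 ≤ largePartEps d L A κ η := by
  unfold largePartEps
  have h1 : (0 : ℝ) ≤ A ^ (-(1 - η⁻¹) : ℝ) := Real.rpow_nonneg hA _
  positivity

/-- **The counting inequality of Lemma 10.2**: with the closure gain `η |X̄|_{k+1} ≤ |X|_k` for
large connected `X` (`η > 0`; useful for `η > 1`), `0 ≤ κ ≤ A`, `A ≥ 1` and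
`2^{L^d} κ A^{−(1−1/η)} ≤ 1`,
`Σ_{X ∈ 𝒫_k^c∖ℬ_k, π(X)=U} κ^{|X|_k} A^{−|X|_k} ≤ ε(A) A^{−|U|_{k+1}}` for every non-empty
`(k+1)`-polymer `U`. [cite: AdamsBuchholzKoteckyMuller2019, proof of Lemma 10.2 (10.8)–(10.9)] -/
theorem sum_largePartIndex_le {s L t : ℕ} (hM : M = L * s * t) (hs : Odd s) (hL : Odd L) (ht : Odd t)
    {A κ η : ℝ} (hA : 1 ≤ A) (hκ : 0 ≤ κ) (hκA : κ ≤ A) (hη : 0 < η)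
    (hsmall : (2 : ℝ) ^ (L ^ d) * (κ * A ^ (-(1 - η⁻¹) : ℝ)) ≤ 1)
    (hgain : ∀ X : Finset (Fin d → ZMod M), IsPolymer s X → IsConn X → 2 ^ d < (blocks s X).card →
      η * ((blocks (L * s) (closure (L * s) X)).card : ℝ) ≤ (blocks s X).card)
    {U : Finset (Fin d → ZMod M)} (hU : IsPolymer (L * s) U) (hUne : U.Nonempty) :
    ∑ X ∈ largePartIndex s L U, κ ^ (blocks s X).card * (A ^ (blocks s X).card)⁻¹
      ≤ largePartEps d L A κ η * (A ^ (blocks (L * s) U).card)⁻¹ := by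
  have hA0 : 0 < A := by linarith
  set n := (blocks (L * s) U).card with hn
  have hn1 : n ≠ 0 := by
    obtain ⟨u, hu⟩ := hUne
    exact (card_pos.2 ⟨blockOf (L * s) u, mem_blocks.2 ⟨u, hu, rfl⟩⟩).ne'
  have hAn : 0 < A ^ n := pow_pos hA0 n
  set κ' : ℝ := κ * A ^ (-(1 - η⁻¹) : ℝ) with hκ'
  have hκ'0 : 0 ≤ κ' := mul_nonneg hκ (Real.rpow_nonneg hA0.le _)
  have hκ'1 : κ' ≤ 1 := by
    have h2 : (1 : ℝ) ≤ 2 ^ (L ^ d) := one_le_pow₀ (by norm_num)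
    nlinarith
  -- split into large (`|X|_k > 2^d`) and small non-block polymers
  rw [← sum_filter_add_sum_filter_not (largePartIndex s L U) (fun X => 2 ^ d < (blocks s X).card)]
  -- (10.8): the large polymers
  have hlarge : ∑ X ∈ (largePartIndex s L U).filter (fun X => 2 ^ d < (blocks s X).card),
      κ ^ (blocks s X).card * (A ^ (blocks s X).card)⁻¹ ≤ (2 : ℝ) ^ (L ^ d) * κ' * (A ^ n)⁻¹ := by
    have hsub : (largePartIndex s L U).filter (fun X => 2 ^ d < (blocks s X).card)
        ⊆ (polys s U).filter (fun X => closure (L * s) X = U) := by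
      intro X hX
      obtain ⟨hXI, hXl⟩ := mem_filter.1 hX
      obtain ⟨hP, hc, -, hr⟩ := mem_largePartIndex.1 hXI
      rw [TorusPolymer.reblock_of_isConn_of_lt_card s (L * s) hc hXl] at hr
      refine mem_filter.2 ⟨mem_polys.2 ⟨?_, hP⟩, hr⟩
      rw [← hr]; exact TorusPolymer.subset_closure _ X
    have hterm : ∀ X ∈ (largePartIndex s L U).filter (fun X => 2 ^ d < (blocks s X).card),
        κ ^ (blocks s X).card * (A ^ (blocks s X).card)⁻¹ ≤ κ' ^ (blocks s X).card * (A ^ n)⁻¹ := by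
      intro X hX
      obtain ⟨hXI, hXl⟩ := mem_filter.1 hX
      obtain ⟨hP, hc, -, hr⟩ := mem_largePartIndex.1 hXI
      have hg := hgain X hP hc hXl
      rw [← TorusPolymer.reblock_of_isConn_of_lt_card s (L * s) hc hXl, hr] at hg
      have hgt := TorusPolymer.gain_term_le_pow hA hη hg
      rw [hκ', mul_pow]
      calc κ ^ (blocks s X).card * (A ^ (blocks s X).card)⁻¹
          = κ ^ (blocks s X).card * (A ^ n * (A ^ (blocks s X).card)⁻¹) * (A ^ n)⁻¹ := by
            field_simp
        _ ≤ κ ^ (blocks s X).card * (A ^ (-(1 - η⁻¹) : ℝ)) ^ (blocks s X).card * (A ^ n)⁻¹ :=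
            mul_le_mul_of_nonneg_right (mul_le_mul_of_nonneg_left hgt (pow_nonneg hκ _))
              (inv_nonneg.2 hAn.le)
    refine (sum_le_sum hterm).trans ?_
    rw [← sum_mul]
    refine mul_le_mul_of_nonneg_right ?_ (inv_nonneg.2 hAn.le)
    refine (sum_le_sum_of_subset_of_nonneg hsub fun X _ _ => pow_nonneg hκ'0 _).trans ?_
    refine (TorusPolymer.sum_pow_card_blocks_le hM hs hL ht hU hκ'0 hκ'1).trans ?_
    exact pow_le_of_le_one (mul_nonneg (pow_nonneg (by norm_num) _) hκ'0) hsmall hn1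
  -- (10.9): the small non-block polymers (`π(X)` is then a single block meeting `X`)
  have hsmallsum : ∑ X ∈ (largePartIndex s L U).filter (fun X => ¬ 2 ^ d < (blocks s X).card),
      κ ^ (blocks s X).card * (A ^ (blocks s X).card)⁻¹
        ≤ (L : ℝ) ^ d * smallPolymerConst d * κ ^ 2 * A⁻¹ * (A ^ n)⁻¹ := by
    set S := (largePartIndex s L U).filter (fun X => ¬ 2 ^ d < (blocks s X).card) with hS
    by_cases he : S = ∅
    · rw [he, sum_empty]
      have : (0 : ℝ) ≤ smallPolymerConst d := Nat.cast_nonneg _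
      positivity
    obtain ⟨X₀, hX₀⟩ := nonempty_iff_ne_empty.2 he
    obtain ⟨hX₀I, hX₀s⟩ := mem_filter.1 hX₀
    obtain ⟨-, hc₀, -, hr₀⟩ := mem_largePartIndex.1 hX₀I
    obtain ⟨x₀, -, hx₀⟩ := TorusPolymer.reblock_of_isConn_of_card_le s (L * s) hc₀ (not_lt.1 hX₀s)
    have hUb : U = blockOf (L * s) x₀ := hr₀.symm.trans hx₀
    have hn' : n = 1 := by rw [hn, hUb, TorusPolymer.blocks_blockOf, card_singleton]
    -- every `X ∈ S` is a small connected polymer meeting the block `U`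
    have hsub : S ⊆ (polys s univ).filter fun X => IsConn X ∧ (blocks s X).card ≤ 2 ^ d ∧
        ¬ Disjoint X (blockOf (L * s) x₀) := by
      intro X hX
      obtain ⟨hXI, hXs⟩ := mem_filter.1 hX
      obtain ⟨hP, hc, -, hr⟩ := mem_largePartIndex.1 hXI
      obtain ⟨x, hxX, hx⟩ := TorusPolymer.reblock_of_isConn_of_card_le s (L * s) hc (not_lt.1 hXs)
      refine mem_filter.2 ⟨mem_polys.2 ⟨subset_univ _, hP⟩, hc, not_lt.1 hXs, ?_⟩
      rw [not_disjoint_iff]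
      refine ⟨x, hxX, ?_⟩
      rw [← hUb, ← hr, hx]
      exact TorusPolymer.mem_blockOf_self _ x
    have hcard : (S.card : ℝ) ≤ (L : ℝ) ^ d * smallPolymerConst d := by
      have := (card_le_card hsub).trans (TorusPolymer.card_small_meeting_block_le hM hs hL ht x₀)
      rw [smallPolymerConst]
      exact_mod_cast this
    -- each term is `≤ (κ/A)^2`
    have hκA' : κ * A⁻¹ ≤ 1 := by rw [← div_eq_mul_inv, div_le_one hA0]; exact hκA
    have hterm : ∀ X ∈ S, κ ^ (blocks s X).card * (A ^ (blocks s X).card)⁻¹ ≤ κ ^ 2 * A⁻¹ * (A ^ n)⁻¹ := by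
      intro X hX
      obtain ⟨-, -, h2, -⟩ := mem_largePartIndex.1 (mem_filter.1 hX).1
      rw [hn', pow_one, ← inv_pow, ← mul_pow, mul_assoc, ← pow_two, ← mul_pow]
      exact pow_le_pow_of_le_one (mul_nonneg hκ (inv_nonneg.2 hA0.le)) hκA' h2
    refine (sum_le_card_nsmul _ _ _ hterm).trans ?_
    rw [nsmul_eq_mul]
    have h0 : 0 ≤ κ ^ 2 * A⁻¹ * (A ^ n)⁻¹ := by positivity
    calc (S.card : ℝ) * (κ ^ 2 * A⁻¹ * (A ^ n)⁻¹)
        ≤ (L : ℝ) ^ d * smallPolymerConst d * (κ ^ 2 * A⁻¹ * (A ^ n)⁻¹) :=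
          mul_le_mul_of_nonneg_right hcard h0
      _ = (L : ℝ) ^ d * smallPolymerConst d * κ ^ 2 * A⁻¹ * (A ^ n)⁻¹ := by ring
  refine (add_le_add hlarge hsmallsum).trans (le_of_eq ?_)
  rw [largePartEps, hκ']
  ring

/-! ## Lemma 10.2 in predicate form -/

/-- **Lemma 10.2 (combinatorial form).**  Suppose every term of `F(U)` obeys, at the gauge `T` and
weight `w` of the target polymer `U`, the bound `|R K(X)|_{T_φ} ≤ C κ^{|X|_k} A^{−|X|_k} w(φ)`
(this is what Lemma 8.4 (`κ = A_𝒫`), Lemma 8.1 and (w6) give), the closure gain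
`η|X̄|_{k+1} ≤ |X|_k` holds for large connected `X`, `0 ≤ κ ≤ A`, `A ≥ 1`, and
`2^{L^d} κ A^{−(1−1/η)} ≤ 1`.  Then `|F(U)|_{T_φ} ≤ C ε(A) A^{−|U|_{k+1}} w(φ)` with
`ε(A) = 2^{L^d} κ A^{−(1−1/η)} + L^d c(d) κ² A^{−1}` — so `‖F‖_{k+1}^{(A)} ≤ ε(A) ‖K‖_k^{(A)}`,
and `ε(A) ≤ ¼θ` for `A ≥ A_0(L)`. [cite: AdamsBuchholzKoteckyMuller2019, Lemma 10.2] -/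
theorem tayNormLE_largePart {s L t : ℕ} (hM : M = L * s * t) (hs : Odd s) (hL : Odd L) (ht : Odd t)
    {V : Type*} [NormedAddCommGroup V] [NormedSpace ℝ V] (T : ((Fin d → ZMod M) → ℝ) →ₗ[ℝ] V)
    {w : ((Fin d → ZMod M) → ℝ) → ℝ} (hw : ∀ φ, 0 ≤ w φ) {r₀ : ℕ}
    {R : (((Fin d → ZMod M) → ℝ) → ℂ) → ((Fin d → ZMod M) → ℝ) → ℂ}
    {K : Finset (Fin d → ZMod M) → ((Fin d → ZMod M) → ℝ) → ℂ}
    {A κ η C : ℝ} (hA : 1 ≤ A) (hκ : 0 ≤ κ) (hκA : κ ≤ A) (hη : 0 < η) (hC : 0 ≤ C)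
    (hsmall : (2 : ℝ) ^ (L ^ d) * (κ * A ^ (-(1 - η⁻¹) : ℝ)) ≤ 1)
    (hgain : ∀ X : Finset (Fin d → ZMod M), IsPolymer s X → IsConn X → 2 ^ d < (blocks s X).card →
      η * ((blocks (L * s) (closure (L * s) X)).card : ℝ) ≤ (blocks s X).card)
    {U : Finset (Fin d → ZMod M)} (hU : IsPolymer (L * s) U) (hUne : U.Nonempty)
    (hRd : ∀ X ∈ largePartIndex s L U, ContDiff ℝ r₀ (R (K X)))
    (hR : ∀ X ∈ largePartIndex s L U,
      TayNormLE T r₀ w (R (K X)) (C * (κ ^ (blocks s X).card * (A ^ (blocks s X).card)⁻¹))) :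
    TayNormLE T r₀ w (largePart s L R K U)
      (C * largePartEps d L A κ η * (A ^ (blocks (L * s) U).card)⁻¹) := by
  have h1 := TayNormLE.sum (largePartIndex s L U) (F := fun X => R (K X)) hR hRd
  have hle : ∑ X ∈ largePartIndex s L U, C * (κ ^ (blocks s X).card * (A ^ (blocks s X).card)⁻¹)
      ≤ C * largePartEps d L A κ η * (A ^ (blocks (L * s) U).card)⁻¹ := by
    rw [← mul_sum, mul_assoc]
    exact mul_le_mul_of_nonneg_left (sum_largePartIndex_le hM hs hL ht hA hκ hκA hη hsmall hgain hU hUne) hC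
  have h2 := h1.mono hle hw
  intro φ
  have := h2 φ
  unfold largePart
  exact this

end Literature.MathematicalPhysics.StatisticalMechanics.GradientRG

end
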